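import Summits.BirchSwinnertonDyer.BirchSwinnertonDyer.Theses.UniversalToricDescent
import Literature.NumberTheory.EllipticCurves.BDPAnticyclotomicPAdicLFunctionHigherWeight
import Literature.NumberTheory.EllipticCurves.Newforms
import HarnessLib

/-!
# NODE (D-0171) on crux stmt-BirchSwinnertonDyer-24207 `UniversalToricDescent.RationalSplitIMCInclusionAtThree`
# — line `adic_congruence_ladder` (crux-ideate seat `cruxidea-stmt-BirchSwinnertonDyer-24207-1` gen 2, 2026-08-30)

KIND: IMPLIED-BY with ONE EQUIVALENT intermediate node (K1 below is ⟺ the crux modulo the true algebra lemma S1;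
its CHILD decomposition K1a ∧ K1b ∧ K1c ⟹ K1 is kernel-checked here; `no_new_routes`).  0 sorry, no new axiom, no fact consumed.
`closes`-analogues CHECKED below (kernel):
* `rationalSplitIMCInclusionAtThree_of_closed_of_membership : ThreeAdicClosedIdeals → LadderMembershipAtThree → crux`
* `ladderMembership_of_ladder : CrystallineLadderAtThree → LadderCongruenceAtThree → UniformLadderInclusionAtThree
     → LadderMembershipAtThree`
* `rationalSplitIMCInclusionAtThree_of_ladder` (the composition; concludes the crux BY NAME).

THE MOVE («3-adic congruence ladder + Krull closedness»).  24207 asks `∃ k, 3^k·L ∈ I` with `I = Ch_Λ(X_(∅,0))·R₀⟦T⟧`.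
Ideals of the compact Noetherian local ring `R₀⟦T⟧` are closed: `⋂ₘ (I + 3^m R₀⟦T⟧) = I` (S1).  So it suffices to produce ONE slack
`k₀` with `3^{k₀}·L ∈ I + (3^m)` for EVERY `m` (K1).  Membership modulo `3^m` only sees `T_f/3^m = E[3^m]`, the BDP local conditions
`(∅ at 𝔭′-side, 0)` do not depend on the form, and the BDP periods `(Ω_K, Ω_p)` are CM periods independent of the form: hence K1 can be
fed RUNG BY RUNG by newforms `g_m` of level `M`, `3 ∤ M`, `M·3^{v₃N} = N` (same tame level), weight `k_m ≡ 2 (mod 4·3^m)`, with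
`a_ℓ(g_m) ≡ a_ℓ(f_E) (mod 3^m)` for all `ℓ ≠ 3` (K1a: a CRYSTALLINE rung — `J(π₃(g_m)) ≠ 0`, the cell's barriers B1 / TraceZero do
not quantify over `g_m`), whose BDP `L`-functions are congruent to `L` (K1b, print pattern Kriz–Li 2019 Thm. 3.9) and satisfy the
Kato-direction inclusion read in `I` modulo `3^m` with slack UNIFORM in the rung (K1c — the research piece).

PIECES AND TAGS (evidence in `Ideas/adic-congruence-ladder.md` §NODE TAGS; summary here):
* S1 `ThreeAdicClosedIdeals` — **WEAKER (true lemma) · leaf ATTACKABLE**: Krull intersection in the Noetherian local ring `R₀⟦T⟧`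
  (`R₀` a complete DVR: tree `isDiscreteValuationRing_unrIntegers`; Mathlib `Ideal.iInf_pow_smul_eq_bot_of_isLocalRing`-pattern); needs
  `IsNoetherianRing (PowerSeries R₀)` which Mathlib has for Noetherian `R₀` (`PowerSeries.isNoetherianRing`)?  If absent: M-sized port.
* K1 `LadderMembershipAtThree` — **EQUIV** (⟸ crux trivially with `k₀ = k`; ⟹ crux by S1).  CHILD = {K1a, K1b, K1c} (this file).
* K1a `CrystallineLadderAtThree` — **UNDECIDED · leaf INSTRUMENTABLE**: «the 3-adic eigensystem of `f_E` (E of class O6) is a STRONG limit of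
  crystalline newforms of the same tame level».  Print: only ZARISKI density of crystalline / modular points (Gouvêa–Mazur, Böckle; Kisin 2010
  Thm. 0.3 [corpus:paper:anon2010-deformations-gqp-gl2-qp-representations p.3]); weak-vs-strong eigenforms mod `p^m` (Chen–Kiming–Wiese) is the
  open issue.  PROVED CONSTRAINTS (card §L1–L3): any such ladder has slopes `v₃(a₃(g_m)) → ∞` (eigencurve accumulation + `ρ_f|G_ℚ₃` not
  trianguline), `v₃(a₃(g_m)) ≤ (k_m−2)/2` (Berger–Li–Zhu vs `ρ̄|G_ℚ₃` reducible), and no rung is `3`-ordinary or locally induced beyond depth 1.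
  Cheapest falsifier: T_ℓ-eigensystem of 135a1 mod 9 among newforms of `S_k(Γ₀(5))`, `k ≡ 2 (mod 12)`, `k ≤ 110` (compute seat; kit 0 here).
  The clause `IsBDPLFunctionWt … g … Lg` (existence of the rung's BDP function with the SAME periods) is print-pattern for `3 ∤ M`
  (BDP 2013 §5, Castella–Hsieh 2018 §3; tree `IsBDPLFunctionWt`).
* K1b `LadderCongruenceAtThree` — **WEAKER-in-kind (analytic congruence) · leaf ATTACKABLE (print pattern)**: congruent `3`-adic modular forms
  of tame level 5 have congruent Katz–BDP CM-measures (`f_E^♭ = f_E` as `a₃ = 0`, `U₃ f_E = 0`; `d^{k/2−1} ≡ id (mod 3^m)` on `3`-depleted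
  forms for `k ≡ 2 (mod 4·3^m)`); Kriz–Li 2019 Thm. 3.9 / §3.1 [corpus:paper:doi-10-1017-fms-2019-9 p.9, p.5] is the weight-(2,2) case with
  stabilisation factors — none needed here (same tame level, `U`-eigenvalues at 5 congruent by the weight congruence).  Why it might fail: the
  crux's `L` is pinned by interpolation only; K1b needs it to BE the CM-measure (tree: LiuZhangZhang2018 additive Waldspurger, imported by
  the route file).
* K1c `UniformLadderInclusionAtThree` — **UNDECIDED · EQUIV-RISK · leaf BARRIER + IDEA-NEEDED**.  Modulo K1b and S1 it is ⟺ the crux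
  (`crux ∧ K1b ⟹ K1c` with `k₀ = k`), so it carries content only through HOW it would be proved: a per-rung Euler-system bound for
  `Sel_(∅,0)(T_{g_m}/3^m = E[3^m])` with loss independent of the rung.  TRUE if the BDP main conjecture holds exactly for every rung.
  Every engine in print loses `3^{O(h_m)}`, `h_m = v₃(a₃(g_m)) → ∞` FORCED (L1), i.e. the cell's B1 / `TraceZeroHeegnerTowerAtAdditiveSplitP`
  re-enter asymptotically; layer-wise `(3^m, ω_n)` statements are moreover capped at depth `e_∞(f) = exp(R₀⟦T⟧/(F, ω_n)) = O_f(1)` (card §L4),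
  so only slack-uniform engines count.  IDEA-NEEDED: a slope-uniform mod-`3^m` Kolyvagin argument for generalized Heegner classes of `g_m`
  in the `(∅,0)` structure (classes must be `𝔭′`-strict: Λ-adic in print, finite-level unknown).

WHY EASIER / WHY NOVEL (one sentence each).  Easier (conditional): every rung is a crystalline point — nonzero Jacquet module at 3, BDP
formula, generalized Heegner classes with non-degenerate (if `3^{h_m}`-lossy) norm relations — none of which exists for `f_E`; the price is
uniformity in the rung, isolated as K1c.  Novel (problem-relative): the cone holds depth-ONE congruence transport (twin `E′`, `E[3] ≅ E′[3]`:
λ/μ profile, L54-7 «mod-3 divisor transport» dead because values mod 3 locate only λ, μ) and level-raising at 3 (dead: same wild type,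
`NoAdmissiblePrimesAtThree`); nobody varied the WEIGHT to change the 3-adic Hodge type of the congruent form and took the depth to ∞, where
closedness (S1) — not a profile — locates the divisor.  Nearest print: Bertolini–Darmon 2005 (mod-`p^m` level-raised congruent forms bound
`Sel_{p^m}`), Kriz–Li 2019 (congruences of BDP values), Chen–Kiming–Wiese 2013 (strong/weak eigenforms mod `p^m`).

INSTRUMENT DATA: none run (kit 0).  Requested: D-g2-1 (mod-9 / mod-27 eigensystem search, K1a falsifier) — see card.
HONEST STATUS: K1c is research and may be the crux in costume unless a slope-uniform engine exists; K1a is a genuinely new, checkable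
arithmetic question; S1, K1b are provable-pattern.  Nothing here proves BSD for any curve.
-/

set_option autoImplicit false
set_option linter.dupNamespace false

noncomputable section

open scoped Classical MatrixGroups ModularForm

namespace Summit.BirchSwinnertonDyer.BirchSwinnertonDyer.Cruxes.RationalSplitIMCInclusionAtThree.AdicCongruenceLadder

open PowerSeries CongruenceSubgroup Literature.NumberTheory.EllipticCurves
  Literature.NumberTheory.EllipticCurves.ModularForms
  Summit.BirchSwinnertonDyer.Rank1Residual.X11b

/-- **Rung predicate.** `g ∈ S_k(Γ₀(M))` is an `m`-th rung of the ladder over `f ∈ S₂(Γ₀(N))` (w.r.t. `ι′ : ℚ̄₃ ≅ ℂ`): same tame level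
(`M·3^{v₃ N} = N`), `g` a newform, `k ≡ 2 (mod 4·3^m)`, and `a_ℓ(g) ≡ a_ℓ(f) (mod 3^m)` for every prime `ℓ ≠ 3` (for `ℓ ∣ M` these are the
`U_ℓ`-eigenvalues, tree `heckeEigenvalue`).  Since `3 ∤ M`, `ρ_g|G_ℚ₃` is crystalline. -/
def IsLadderRung (ι' : PadicAlgCl 3 ≃+* ℂ) {N : ℕ} [NeZero N] (f : CuspForm (Gamma0 N) 2) (m : ℕ)
    {M : ℕ} [NeZero M] {k : ℤ} (g : CuspForm (Gamma0 M) k) : Prop :=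
  M * 3 ^ (padicValNat 3 N) = N ∧ IsNewform0 g ∧ k ≡ 2 [ZMOD ((4 * 3 ^ m : ℕ) : ℤ)] ∧
    ∀ ℓ : ℕ, ℓ.Prime → ℓ ≠ 3 →
      ‖(((ι'.symm (heckeEigenvalue g ℓ - heckeEigenvalue f ℓ)) : PadicAlgCl 3) : ℂ_[3])‖ ≤ ((3 : ℝ) ^ m)⁻¹

/-- **S1 [WEAKER · true lemma · leaf ATTACKABLE]** ideals of `R₀⟦T⟧` are `3`-adically closed (Krull intersection theorem in the
Noetherian local ring `R₀⟦T⟧`, `3 ∈ 𝔪`). -/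
def ThreeAdicClosedIdeals : Prop :=
  ∀ (I : Ideal (UnrSeries 3)) (x : UnrSeries 3),
    (∀ m : ℕ, x ∈ I ⊔ Ideal.span {((3 : ℕ) : UnrSeries 3) ^ m}) → x ∈ I

/-- **K1 [EQUIV to the crux modulo S1; CHILD = K1a ∧ K1b ∧ K1c]** uniform-slack membership modulo every `3^m`: under 24207's binders,
`∃ k₀, ∀ m, 3^{k₀}·L ∈ Ch·R₀⟦T⟧ + (3^m)`. -/
def LadderMembershipAtThree : Prop :=
  ∀ (W : WeierstrassCurve ℚ) [W.IsElliptic] [W.IsGloballyMinimal] (N : ℕ) [NeZero N] (K : Type) [Field K] [NumberField K] (Dt : Literature.NumberTheory.EllipticCurves.ModularForms.ModularParametrizationData W N), Summit.BirchSwinnertonDyer.Rank1Residual.Additive.ClassO6 W 3 → W.HasSurjectiveModNGaloisRep 3 → W.analyticRank = 1 → W.conductorNorm ℤ = N → Literature.NumberTheory.EllipticCurves.IsImaginaryQuadratic K → Literature.NumberTheory.EllipticCurves.SatisfiesHeegnerHypothesis N K → ∀ (κ : Literature.NumberTheory.EllipticCurves.ZpExtension K 3), κ.IsAnticyclotomic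 → ∀ (γ : Field.absoluteGaloisGroup K) [Fact (κ.IsTopGenerator γ)] (𝔭 : IsDedekindDomain.HeightOneSpectrum (NumberField.RingOfIntegers K)), ((3 : ℕ) : NumberField.RingOfIntegers K) ∈ 𝔭.asIdeal → 𝔭.asIdeal.ramificationIdx (NumberField.RingOfIntegers ℚ) = 1 → 𝔭.asIdeal.inertiaDeg (NumberField.RingOfIntegers ℚ) = 1 → ∀ (𝔭' : IsDedekindDomain.HeightOneSpectrum (NumberField.RingOfIntegers K)), ((3 : ℕ) : NumberField.RingOfIntegers K) ∈ 𝔭'.asIdeal → 𝔭' ≠ 𝔭 → ∀ (ι' : PadicAlgCl 3 ≃+* ℂ), Summit.BirchSwinnertonDyer.BirchSwinnertonDyer.Theorems.SchneiderFree.BranchInducesPrime 3 ι' 𝔭 → ∀ (ΩK : ℂ) (Ωp : ℂ_[3]) (L : Literature.NumberTheory.EllipticCurves.UnrSeries 3), ΩK ≠ 0 → Ωp ≠ 0 → Literature.NumberTheory.EllipticCurves.IsBDPLFunction ι' 𝔭 κ γ Dt.f ΩK Ωp L →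
    ∃ k₀ : ℕ, ∀ m : ℕ,
      ((3 : ℕ) : UnrSeries 3) ^ k₀ * L ∈
        (AcSelmer.XAc.charIdeal (W.baseChange K) 3 κ 𝔭' ∅ γ).map (PowerSeries.map (Halves.toUnr 3)) ⊔
          Ideal.span {((3 : ℕ) : UnrSeries 3) ^ m}

/-- **K1a [UNDECIDED · leaf INSTRUMENTABLE]** the crystalline ladder exists: under 24207's binders, for every `m` there is an `m`-th rung
`g` (`IsLadderRung`) together with a BDP `L`-function of `g` for the SAME `(𝔭, κ, γ, Ω_K, Ω_p)` (tree `IsBDPLFunctionWt`). -/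
def CrystallineLadderAtThree : Prop :=
  ∀ (W : WeierstrassCurve ℚ) [W.IsElliptic] [W.IsGloballyMinimal] (N : ℕ) [NeZero N] (K : Type) [Field K] [NumberField K] (Dt : Literature.NumberTheory.EllipticCurves.ModularForms.ModularParametrizationData W N), Summit.BirchSwinnertonDyer.Rank1Residual.Additive.ClassO6 W 3 → W.HasSurjectiveModNGaloisRep 3 → W.analyticRank = 1 → W.conductorNorm ℤ = N → Literature.NumberTheory.EllipticCurves.IsImaginaryQuadratic K → Literature.NumberTheory.EllipticCurves.SatisfiesHeegnerHypothesis N K → ∀ (κ : Literature.NumberTheory.EllipticCurves.ZpExtension K 3), κ.IsAnticyclotomic → ∀ (γ : Field.absoluteGaloisGroup K) [Fact (κ.IsTopGenerator γ)] (𝔭 : IsDedekindDomain.HeightOneSpectrum (NumberField.RingOfIntegers K)), ((3 : ℕ) : NumberField.RingOfIntegers K) ∈ 𝔭.asIdeal → 𝔭.asIdeal.ramificationIdx (NumberField.RingOfIntegers ℚ) = 1 → 𝔭.asIdeal.inertiaDeg (NumberField.RingOfIntegers ℚ) = 1 → ∀ (𝔭' : IsDedekindDomain.HeightOneSpectrum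 (NumberField.RingOfIntegers K)), ((3 : ℕ) : NumberField.RingOfIntegers K) ∈ 𝔭'.asIdeal → 𝔭' ≠ 𝔭 → ∀ (ι' : PadicAlgCl 3 ≃+* ℂ), Summit.BirchSwinnertonDyer.BirchSwinnertonDyer.Theorems.SchneiderFree.BranchInducesPrime 3 ι' 𝔭 → ∀ (ΩK : ℂ) (Ωp : ℂ_[3]) (L : Literature.NumberTheory.EllipticCurves.UnrSeries 3), ΩK ≠ 0 → Ωp ≠ 0 → Literature.NumberTheory.EllipticCurves.IsBDPLFunction ι' 𝔭 κ γ Dt.f ΩK Ωp L →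
    ∀ m : ℕ, ∃ (M : ℕ) (_ : NeZero M) (k : ℤ) (g : CuspForm (Gamma0 M) k) (Lg : UnrSeries 3),
      IsLadderRung ι' Dt.f m g ∧ IsBDPLFunctionWt ι' 𝔭 κ γ g ΩK Ωp Lg

/-- **K1b [WEAKER-in-kind · leaf ATTACKABLE (print pattern Kriz–Li 2019 Thm. 3.9)]** congruent forms have congruent BDP functions:
under 24207's binders, for every `m`-th rung `g` and every BDP function `Lg` of `g` with the same periods, `L − Lg ∈ (3^m)·R₀⟦T⟧`. -/
def LadderCongruenceAtThree : Prop :=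
  ∀ (W : WeierstrassCurve ℚ) [W.IsElliptic] [W.IsGloballyMinimal] (N : ℕ) [NeZero N] (K : Type) [Field K] [NumberField K] (Dt : Literature.NumberTheory.EllipticCurves.ModularForms.ModularParametrizationData W N), Summit.BirchSwinnertonDyer.Rank1Residual.Additive.ClassO6 W 3 → W.HasSurjectiveModNGaloisRep 3 → W.analyticRank = 1 → W.conductorNorm ℤ = N → Literature.NumberTheory.EllipticCurves.IsImaginaryQuadratic K → Literature.NumberTheory.EllipticCurves.SatisfiesHeegnerHypothesis N K → ∀ (κ : Literature.NumberTheory.EllipticCurves.ZpExtension K 3), κ.IsAnticyclotomic → ∀ (γ : Field.absoluteGaloisGroup K) [Fact (κ.IsTopGenerator γ)] (𝔭 : IsDedekindDomain.HeightOneSpectrum (NumberField.RingOfIntegers K)), ((3 : ℕ) : NumberField.RingOfIntegers K) ∈ 𝔭.asIdeal → 𝔭.asIdeal.ramificationIdx (NumberField.RingOfIntegers ℚ) = 1 → 𝔭.asIdeal.inertiaDeg (NumberField.RingOfIntegers ℚ) = 1 → ∀ (𝔭' : IsDedekindDomain.HeightOneSpectrum (NumberField.RingOfIntegers K)), ((3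 : ℕ) : NumberField.RingOfIntegers K) ∈ 𝔭'.asIdeal → 𝔭' ≠ 𝔭 → ∀ (ι' : PadicAlgCl 3 ≃+* ℂ), Summit.BirchSwinnertonDyer.BirchSwinnertonDyer.Theorems.SchneiderFree.BranchInducesPrime 3 ι' 𝔭 → ∀ (ΩK : ℂ) (Ωp : ℂ_[3]) (L : Literature.NumberTheory.EllipticCurves.UnrSeries 3), ΩK ≠ 0 → Ωp ≠ 0 → Literature.NumberTheory.EllipticCurves.IsBDPLFunction ι' 𝔭 κ γ Dt.f ΩK Ωp L →
    ∀ (m M : ℕ) [NeZero M] (k : ℤ) (g : CuspForm (Gamma0 M) k), IsLadderRung ι' Dt.f m g →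
      ∀ Lg : UnrSeries 3, IsBDPLFunctionWt ι' 𝔭 κ γ g ΩK Ωp Lg →
        L - Lg ∈ Ideal.span {((3 : ℕ) : UnrSeries 3) ^ m}

/-- **K1c [UNDECIDED · EQUIV-RISK · leaf BARRIER + IDEA-NEEDED]** rung-uniform Kato-direction inclusion read in `f`'s ideal modulo `3^m`:
under 24207's binders there is ONE `k₀` such that for every `m`, every `m`-th rung `g` and every BDP function `Lg` of `g` with the same
periods, `3^{k₀}·Lg ∈ Ch_Λ(X_(∅,0)(E/K_∞))·R₀⟦T⟧ + (3^m)` (the right side only sees `E[3^m] ≅ T_g/3^m` and form-independent local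
conditions). -/
def UniformLadderInclusionAtThree : Prop :=
  ∀ (W : WeierstrassCurve ℚ) [W.IsElliptic] [W.IsGloballyMinimal] (N : ℕ) [NeZero N] (K : Type) [Field K] [NumberField K] (Dt : Literature.NumberTheory.EllipticCurves.ModularForms.ModularParametrizationData W N), Summit.BirchSwinnertonDyer.Rank1Residual.Additive.ClassO6 W 3 → W.HasSurjectiveModNGaloisRep 3 → W.analyticRank = 1 → W.conductorNorm ℤ = N → Literature.NumberTheory.EllipticCurves.IsImaginaryQuadratic K → Literature.NumberTheory.EllipticCurves.SatisfiesHeegnerHypothesis N K → ∀ (κ : Literature.NumberTheory.EllipticCurves.ZpExtension K 3), κ.IsAnticyclotomic → ∀ (γ : Field.absoluteGaloisGroup K) [Fact (κ.IsTopGenerator γ)] (𝔭 : IsDedekindDomain.HeightOneSpectrum (NumberField.RingOfIntegers K)), ((3 : ℕ) : NumberField.RingOfIntegers K) ∈ 𝔭.asIdeal → 𝔭.asIdeal.ramificationIdx (NumberField.RingOfIntegers ℚ) = 1 → 𝔭.asIdeal.inertiaDeg (NumberField.RingOfIntegers ℚ) = 1 → ∀ (𝔭' : IsDedekindDomain.HeightOneSpectrum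 (NumberField.RingOfIntegers K)), ((3 : ℕ) : NumberField.RingOfIntegers K) ∈ 𝔭'.asIdeal → 𝔭' ≠ 𝔭 → ∀ (ι' : PadicAlgCl 3 ≃+* ℂ), Summit.BirchSwinnertonDyer.BirchSwinnertonDyer.Theorems.SchneiderFree.BranchInducesPrime 3 ι' 𝔭 → ∀ (ΩK : ℂ) (Ωp : ℂ_[3]) (L : Literature.NumberTheory.EllipticCurves.UnrSeries 3), ΩK ≠ 0 → Ωp ≠ 0 → Literature.NumberTheory.EllipticCurves.IsBDPLFunction ι' 𝔭 κ γ Dt.f ΩK Ωp L →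
    ∃ k₀ : ℕ, ∀ (m M : ℕ) [NeZero M] (k : ℤ) (g : CuspForm (Gamma0 M) k), IsLadderRung ι' Dt.f m g →
      ∀ Lg : UnrSeries 3, IsBDPLFunctionWt ι' 𝔭 κ γ g ΩK Ωp Lg →
        ((3 : ℕ) : UnrSeries 3) ^ k₀ * Lg ∈
          (AcSelmer.XAc.charIdeal (W.baseChange K) 3 κ 𝔭' ∅ γ).map (PowerSeries.map (Halves.toUnr 3)) ⊔
            Ideal.span {((3 : ℕ) : UnrSeries 3) ^ m}

/-- **S1 ∧ K1 ⟹ crux** (kernel-checked, BY NAME): closedness turns uniform-slack membership modulo every `3^m` into membership. -/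
theorem rationalSplitIMCInclusionAtThree_of_closed_of_membership
    (hS : ThreeAdicClosedIdeals) (hK : LadderMembershipAtThree) :
    Summit.BirchSwinnertonDyer.BirchSwinnertonDyer.Theses.UniversalToricDescent.RationalSplitIMCInclusionAtThree := by
  intro W _ _ N _ K _ _ Dt hO6 hsurj hr1 hN hK' hH κ hκ γ _ 𝔭 h𝔭 he hf 𝔭' h𝔭' hne ι' hι ΩK Ωp L hΩK hΩp hL
  obtain ⟨k₀, hk₀⟩ :=
    hK W N K Dt hO6 hsurj hr1 hN hK' hH κ hκ γ 𝔭 h𝔭 he hf 𝔭' h𝔭' hne ι' hι ΩK Ωp L hΩK hΩp hL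
  exact ⟨k₀, hS _ _ hk₀⟩

/-- **K1a ∧ K1b ∧ K1c ⟹ K1** (kernel-checked): at rung `m`, `3^{k₀}·L = 3^{k₀}·Lg + 3^{k₀}·(L − Lg)` with the first summand in
`I + (3^m)` (K1c) and the second in `(3^m)` (K1b). -/
theorem ladderMembership_of_ladder
    (hA : CrystallineLadderAtThree) (hB : LadderCongruenceAtThree) (hC : UniformLadderInclusionAtThree) :
    LadderMembershipAtThree := by
  intro W _ _ N _ K _ _ Dt hO6 hsurj hr1 hN hK hH κ hκ γ _ 𝔭 h𝔭 he hf 𝔭' h𝔭' hne ι' hι ΩK Ωp L hΩK hΩp hL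
  obtain ⟨k₀, hk₀⟩ :=
    hC W N K Dt hO6 hsurj hr1 hN hK hH κ hκ γ 𝔭 h𝔭 he hf 𝔭' h𝔭' hne ι' hι ΩK Ωp L hΩK hΩp hL
  refine ⟨k₀, fun m => ?_⟩
  obtain ⟨M, hM, k, g, Lg, hrung, hLg⟩ :=
    hA W N K Dt hO6 hsurj hr1 hN hK hH κ hκ γ 𝔭 h𝔭 he hf 𝔭' h𝔭' hne ι' hι ΩK Ωp L hΩK hΩp hL m
  haveI : NeZero M := hM
  have h1 := hk₀ m M k g hrung Lg hLg
  have h2 :=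
    hB W N K Dt hO6 hsurj hr1 hN hK hH κ hκ γ 𝔭 h𝔭 he hf 𝔭' h𝔭' hne ι' hι ΩK Ωp L hΩK hΩp hL m M k g hrung Lg hLg
  have heq : ((3 : ℕ) : UnrSeries 3) ^ k₀ * L =
      ((3 : ℕ) : UnrSeries 3) ^ k₀ * Lg + ((3 : ℕ) : UnrSeries 3) ^ k₀ * (L - Lg) := by ring
  rw [heq]
  exact Submodule.add_mem _ h1 (Ideal.mem_sup_right (Ideal.mul_mem_left _ _ h2))

/-- **The ladder (kernel-checked composition, BY NAME).** S1 ∧ K1a ∧ K1b ∧ K1c ⟹ UTD's rational wall 24207. -/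
theorem rationalSplitIMCInclusionAtThree_of_ladder
    (hS : ThreeAdicClosedIdeals) (hA : CrystallineLadderAtThree) (hB : LadderCongruenceAtThree)
    (hC : UniformLadderInclusionAtThree) :
    Summit.BirchSwinnertonDyer.BirchSwinnertonDyer.Theses.UniversalToricDescent.RationalSplitIMCInclusionAtThree :=
  rationalSplitIMCInclusionAtThree_of_closed_of_membership hS (ladderMembership_of_ladder hA hB hC)

/-- **Converse bookkeeping (EQUIV evidence for K1):** the crux implies K1 with `k₀ = k` (so K1 is not weaker than the crux). -/
theorem ladderMembership_of_crux
    (h : Summit.BirchSwinnertonDyer.BirchSwinnertonDyer.Theses.UniversalToricDescent.RationalSplitIMCInclusionAtThree) :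
    LadderMembershipAtThree := by
  intro W _ _ N _ K _ _ Dt hO6 hsurj hr1 hN hK hH κ hκ γ _ 𝔭 h𝔭 he hf 𝔭' h𝔭' hne ι' hι ΩK Ωp L hΩK hΩp hL
  obtain ⟨k, hk⟩ := h W N K Dt hO6 hsurj hr1 hN hK hH κ hκ γ 𝔭 h𝔭 he hf 𝔭' h𝔭' hne ι' hι ΩK Ωp L hΩK hΩp hL
  exact ⟨k, fun m => Ideal.mem_sup_left hk⟩

/-- **EQUIV-RISK evidence for K1c:** the crux together with K1b implies K1c with `k₀ = k` — so K1c has content only through a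
rung-specific proof. -/
theorem uniformLadderInclusion_of_crux_of_congruence
    (h : Summit.BirchSwinnertonDyer.BirchSwinnertonDyer.Theses.UniversalToricDescent.RationalSplitIMCInclusionAtThree)
    (hB : LadderCongruenceAtThree) : UniformLadderInclusionAtThree := by
  intro W _ _ N _ K _ _ Dt hO6 hsurj hr1 hN hK hH κ hκ γ _ 𝔭 h𝔭 he hf 𝔭' h𝔭' hne ι' hι ΩK Ωp L hΩK hΩp hL
  obtain ⟨k, hk⟩ := h W N K Dt hO6 hsurj hr1 hN hK hH κ hκ γ 𝔭 h𝔭 he hf 𝔭' h𝔭' hne ι' hι ΩK Ωp L hΩK hΩp hL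
  refine ⟨k, fun m M _ k' g hrung Lg hLg => ?_⟩
  have h2 :=
    hB W N K Dt hO6 hsurj hr1 hN hK hH κ hκ γ 𝔭 h𝔭 he hf 𝔭' h𝔭' hne ι' hι ΩK Ωp L hΩK hΩp hL m M k' g hrung Lg hLg
  have heq : ((3 : ℕ) : UnrSeries 3) ^ k * Lg =
      ((3 : ℕ) : UnrSeries 3) ^ k * L - ((3 : ℕ) : UnrSeries 3) ^ k * (L - Lg) := by ring
  rw [heq]
  exact Submodule.sub_mem _ (Ideal.mem_sup_left hk) (Ideal.mem_sup_right (Ideal.mul_mem_left _ _ h2))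

end Summit.BirchSwinnertonDyer.BirchSwinnertonDyer.Cruxes.RationalSplitIMCInclusionAtThree.AdicCongruenceLadder

end
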